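import Literature.Analysis.SpecialFunctions.LegendreHilbertBasis
import Literature.Analysis.SpecialFunctions.LegendreCoefficientBound
import HarnessLib

/-!
# Legendre coefficients of smooth functions in the Hilbert-basis currency of `L²([-1,1])`

Topic `Literature/Analysis/SpecialFunctions`, joining `LegendreCoefficientBound` (Rodrigues + `n`-fold
integration by parts: `|∫_{-1}^1 P_n g| ≤ sup|g⁽ⁿ⁾|·2^{n+1}n!/(2n+1)!`) to `LegendreHilbertBasis`
(`legendreBasis : HilbertBasis ℕ ℂ L²([-1,1])`, `P̃_n = c_n P_n`, `c_n = √((2n+1)/2)`):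

* `inner_legendreL2_toLp_ofReal` — `⟪P̃_n, g⟫ = c_n ∫_{-1}^1 P_n(x) g(x) dx` for the `L²([-1,1])` class
  `(memLp_legendreMeasure_of_continuous _ 2).toLp (fun x => (g x : ℂ))` of a continuous real `g`;
* `norm_inner_legendreL2_le_of_iteratedDeriv_le` — `g ∈ Cⁿ`, `|g⁽ⁿ⁾| ≤ M` on `[−1,1]` ⇒
  `‖⟪P̃_n, g⟫‖ ≤ c_n · M · 2^{n+1} n!/(2n+1)!`;
* `norm_inner_legendreL2_cos_le` — `‖⟪P̃_n, cos(a·)⟫‖ ≤ c_n · |a|ⁿ · 2^{n+1} n!/(2n+1)!` (uniform in the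
  frequency on compacts).

With Mathlib's `HilbertBasis.hasSum_inner_mul_inner legendreBasis h (cos(a·))`
(`Σ_n ⟪h, P̃_n⟫⟪P̃_n, cos(a·)⟫ = ⟪h, cos(a·)⟫`) these give explicit control of pairings `∫ h(x)cos(ax)dx`
from the Legendre coefficients of `h` — the form used for the prolate eigenvalues
`λ(n)ψ_n(ω₀) = ∫ψ_n(x)cos(2πω₀x)dx` (cell rh-crit, K3 tail input, track (iv)).
RH-FREE classical analysis; WHAT THIS IS NOT: an eigenvalue bound or anything about RH — nothing here bears on
the truth of RH.  Everything PROVED; theorems only, no definition, no named fact (net debt 0).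

## References
* G. B. Arfken, H. J. Weber, *Mathematical Methods for Physicists*, 4th ed. (1995), §12.4 Rodrigues' formula,
  Ex. 12.4.2–12.4.4. [ArfkenWeber1995]
* M. Reed, B. Simon, *Methods of Modern Mathematical Physics I* (1980), §II.3 (Legendre ONB). [ReedSimonI1980]
-/

noncomputable section

open MeasureTheory Set Filter Topology Polynomial intervalIntegral
open scoped ENNReal InnerProductSpace ComplexConjugate Nat

namespace Literature.Analysis.SpecialFunctions

/-- **The Legendre coefficients of a continuous real function**: `⟪P̃_n, g⟫ = c_n ∫_{-1}^1 P_n(x) g(x) dx`.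
[cite: ReedSimonI1980, §II.3; ArfkenWeber1995, §12.4] -/
theorem inner_legendreL2_toLp_ofReal (g : ℝ → ℝ) (hg : Continuous g) (n : ℕ) :
    ⟪legendreL2 n, ((memLp_legendreMeasure_of_continuous (f := fun x => (g x : ℂ))
      (Complex.continuous_ofReal.comp hg) 2).toLp fun x => (g x : ℂ))⟫_ℂ =
      ((legendreNormConst n * ∫ x in (-1 : ℝ)..1, (legendre n).eval x * g x : ℝ) : ℂ) := by
  rw [inner_legendreL2_left]
  have h1 : (fun x => conj (legendreFn n x) * (((memLp_legendreMeasure_of_continuous (f := fun x => (g x : ℂ))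
      (Complex.continuous_ofReal.comp hg) 2).toLp fun x => (g x : ℂ)) : ℝ → ℂ) x)
      =ᵐ[legendreMeasure] fun x => ((legendreNormConst n * ((legendre n).eval x * g x) : ℝ) : ℂ) := by
    filter_upwards [MemLp.coeFn_toLp
      (memLp_legendreMeasure_of_continuous (f := fun x => (g x : ℂ))
      (Complex.continuous_ofReal.comp hg) 2)] with x hx
    rw [hx, conj_legendreFn, legendreFn_apply]
    push_cast
    ring
  rw [integral_congr_ae h1, integral_complex_ofReal, integral_legendreMeasure_eq_intervalIntegral,
    intervalIntegral.integral_const_mul]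

/-- **Decay of the Legendre coefficients in `L²([-1,1])`**: for `g ∈ Cⁿ` with `|g⁽ⁿ⁾| ≤ M` on `[−1, 1]`,
`‖⟪P̃_n, g⟫‖ ≤ c_n · M · 2^{n+1} n!/(2n+1)!`, `c_n = √((2n+1)/2)`.
[cite: ArfkenWeber1995, §12.4 Rodrigues' formula p. 587 and Ex. 12.4.2–12.4.4 p. 588; ReedSimonI1980, §II.3] -/
theorem norm_inner_legendreL2_le_of_iteratedDeriv_le (n : ℕ) {g : ℝ → ℝ} (hg : ContDiff ℝ n g) {M : ℝ}
    (hM : ∀ x ∈ Icc (-1 : ℝ) 1, |iteratedDeriv n g x| ≤ M) :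
    ‖⟪legendreL2 n, ((memLp_legendreMeasure_of_continuous (f := fun x => (g x : ℂ))
      (Complex.continuous_ofReal.comp hg.continuous) 2).toLp
        fun x => (g x : ℂ))⟫_ℂ‖ ≤
      legendreNormConst n * (M * (2 ^ (n + 1) * n ! / (2 * n + 1)!)) := by
  rw [inner_legendreL2_toLp_ofReal g hg.continuous, Complex.norm_real, Real.norm_eq_abs, abs_mul,
    abs_of_pos (legendreNormConst_pos n)]
  exact mul_le_mul_of_nonneg_left (abs_integral_legendre_mul_le n hg hM) (legendreNormConst_pos n).le

/-- **Legendre coefficients of a cosine wave in `L²([-1,1])`, uniformly in the frequency**: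
`‖⟪P̃_n, cos(a·)⟫‖ ≤ c_n · |a|ⁿ · 2^{n+1} n!/(2n+1)!`.
[cite: ArfkenWeber1995, §12.4 Rodrigues' formula p. 587 and Ex. 12.4.2–12.4.4 p. 588; ReedSimonI1980, §II.3] -/
theorem norm_inner_legendreL2_cos_le (n : ℕ) (a : ℝ) :
    ‖⟪legendreL2 n, ((memLp_legendreMeasure_of_continuous (f := fun x => (Real.cos (a * x) : ℂ))
        (Complex.continuous_ofReal.comp (Real.continuous_cos.comp (continuous_const.mul continuous_id))) 2).toLp
        fun x => (Real.cos (a * x) : ℂ))⟫_ℂ‖ ≤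
      legendreNormConst n * (|a| ^ n * (2 ^ (n + 1) * n ! / (2 * n + 1)!)) := by
  rw [inner_legendreL2_toLp_ofReal (fun x => Real.cos (a * x))
      (Real.continuous_cos.comp (continuous_const.mul continuous_id)),
    Complex.norm_real, Real.norm_eq_abs, abs_mul,
    abs_of_pos (legendreNormConst_pos n)]
  exact mul_le_mul_of_nonneg_left (abs_integral_legendre_mul_cos_le n a) (legendreNormConst_pos n).le

/-- The frequency-uniform form: `|a| ≤ A ⇒ ‖⟪P̃_n, cos(a·)⟫‖ ≤ c_n · Aⁿ · 2^{n+1} n!/(2n+1)!`.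
[cite: ArfkenWeber1995, §12.4 Rodrigues' formula p. 587 and Ex. 12.4.2–12.4.4 p. 588] -/
theorem norm_inner_legendreL2_cos_le_of_abs_le (n : ℕ) {a A : ℝ} (ha : |a| ≤ A) :
    ‖⟪legendreL2 n, ((memLp_legendreMeasure_of_continuous (f := fun x => (Real.cos (a * x) : ℂ))
        (Complex.continuous_ofReal.comp (Real.continuous_cos.comp (continuous_const.mul continuous_id))) 2).toLp
        fun x => (Real.cos (a * x) : ℂ))⟫_ℂ‖ ≤
      legendreNormConst n * (A ^ n * (2 ^ (n + 1) * n ! / (2 * n + 1)!)) := by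
  refine (norm_inner_legendreL2_cos_le n a).trans ?_
  have := legendreNormConst_pos n
  gcongr

/-- **Pairings against a cosine wave through the Legendre expansion**: for every `h ∈ L²([-1,1])`,
`Σ_n ⟪h, P̃_n⟫ ⟪P̃_n, cos(a·)⟫ = ⟪h, cos(a·)⟫` (Parseval in the Legendre Hilbert basis; with
`norm_inner_legendreL2_cos_le` each term is explicitly controlled).
[cite: ReedSimonI1980, §II.3 (orthonormal bases, Parseval)] -/
theorem hasSum_inner_legendreL2_mul_inner_cos (h : Lp ℂ 2 legendreMeasure) (a : ℝ) :
    HasSum (fun n => ⟪h, legendreL2 n⟫_ℂ *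
      ⟪legendreL2 n, ((memLp_legendreMeasure_of_continuous (f := fun x => (Real.cos (a * x) : ℂ))
        (Complex.continuous_ofReal.comp (Real.continuous_cos.comp (continuous_const.mul continuous_id))) 2).toLp
        fun x => (Real.cos (a * x) : ℂ))⟫_ℂ)
      ⟪h, ((memLp_legendreMeasure_of_continuous (f := fun x => (Real.cos (a * x) : ℂ))
        (Complex.continuous_ofReal.comp (Real.continuous_cos.comp (continuous_const.mul continuous_id))) 2).toLp
        fun x => (Real.cos (a * x) : ℂ))⟫_ℂ := by
  have hs := legendreBasis.hasSum_inner_mul_inner h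
    ((memLp_legendreMeasure_of_continuous (f := fun x => (Real.cos (a * x) : ℂ))
        (Complex.continuous_ofReal.comp (Real.continuous_cos.comp (continuous_const.mul continuous_id))) 2).toLp
        fun x => (Real.cos (a * x) : ℂ))
  simpa only [coe_legendreBasis] using hs

end Literature.Analysis.SpecialFunctions
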